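import Summits.Ventures.YMGap.RobustBall.HeatBathPoincare
import Summits.Ventures.YMGap.Thresholds.ImprovedThresholdSU3PV2
import Literature.MathematicalPhysics.QuantumFieldTheory.Balaban1983to89.StrongCouplingKernelWindow
import HarnessLib

/-!
# Robust ball (Y2) — heat-bath Poincaré inequality uniformly in the volume: every-`SU(N)` and `SU(3)` hypothesis-free cells

HONEST FRAMING: venture file of the cell `pub-ymgap` (QuantumFields programme), track ROBUST-BALL, seat rb-p2 (g12); cells of
`HeatBathPoincare.heatBathPoincare_of_oneLinkKRModulus` (the single-link heat-bath / Glauber Poincaré inequality of the torus `SU(N)` Wilson measures on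
`(ℤ/L)⁴`, `L ≥ 2`, with a volume-independent constant, from a one-link Kantorovich–Rubinstein modulus).  LATTICE statements at strong coupling; nothing
about `β → ∞`, the continuum or Clay.
* ★★ `suN_heatBathPoincare_bakryEmery` — EVERY `SU(N)`, `N ≥ 2`, HYPOTHESIS-FREE, on Shen–Zhu–Zhu's printed window 't Hooft `0 ≤ b < 1/48`
  (Bakry–Émery modulus `StrongCouplingKernelWindow.oneLinkKRModulus_SU`, `K = 1/(1/2 − 6b)`): constant `(2(1 − 18b/(1/2 − 6b)))⁻¹` — the discrete-dynamics
  twin of SZZ's Langevin Poincaré inequality (CMP 400 (2023) Thm. 4.2 / Cor. 4.4), same window, every torus.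
* ★★ `su3_heatBathPoincare_pv2` — `SU(3)`, `d = 4`, HYPOTHESIS-FREE on `0 ≤ β_W < 625/2679 ≈ 0.233` (engine-2's certified modulus
  `OneLinkVarianceSDC.su3_oneLinkKRModulus_pv2_oneFifth : OneLinkKRModulus 3 (1/5) (2679/1250)`; tree coupling `β_W/3`): constant `(2(1 − 2679β_W/625))⁻¹`.
0 sorry, 0 definitions.  References: Wu 2006; Ollivier 2009; Shen–Zhu–Zhu 2023.  Everything here is proved. [folklore]
-/

noncomputable section

open MeasureTheory Function
open Literature.MathematicalPhysics.QuantumLattice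
open Literature.MathematicalPhysics.QuantumFieldTheory.Balaban1983to89

namespace Summit.Ventures.YMGap.RobustBall.HeatBathPoincare

variable {N : ℕ}

/-- ★★ **EVERY `SU(N)`, `N ≥ 2`, `d = 4`, HYPOTHESIS-FREE (Bakry–Émery modulus `K = 1/(1/2 − 6b)`): the heat-bath Poincaré inequality uniformly in the
volume on Shen–Zhu–Zhu's printed window 't Hooft `0 ≤ b < 1/48`** (tree coupling `N b`; constant `(2(1 − 18b/(1/2 − 6b)))⁻¹`, every torus side `L ≥ 2`).
[folklore] -/
theorem suN_heatBathPoincare_bakryEmery (hN : 2 ≤ N) {b : ℝ} (hb0 : 0 ≤ b) (hb : b < 1 / 48) {L : ℕ} [NeZero L] (hL : 1 < L)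
    (F : Literature.MathematicalPhysics.QuantumFieldTheory.GaugeConfig 4 L (Matrix.specialUnitaryGroup (Fin N) ℂ) → ℝ) (hF : Measurable F)
    (hFb : ∃ M : ℝ, ∀ U, |F U| ≤ M) :
    ProbabilityTheory.variance F
        (Literature.MathematicalPhysics.QuantumFieldTheory.wilsonMeasure (d := 4) (L := L) (fundamentalRep (Fin N)) ((N : ℝ) * b)) ≤
      (2 * (1 - 18 * b / (1 / 2 - 6 * b)))⁻¹ *
        ∑ ℓ : Literature.MathematicalPhysics.QuantumFieldTheory.Edge 4 L, ∫ U, ∫ g, (F U - F (update U ℓ g)) ^ 2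
          ∂((Literature.MathematicalPhysics.QuantumFieldTheory.haarProbability (Matrix.specialUnitaryGroup (Fin N) ℂ)).tilted
              (fun g' => -((N : ℝ) * b) *
                Literature.MathematicalPhysics.QuantumFieldTheory.wilsonAction (fundamentalRep (Fin N)) (update U ℓ g')))
          ∂(Literature.MathematicalPhysics.QuantumFieldTheory.wilsonMeasure (d := 4) (L := L) (fundamentalRep (Fin N)) ((N : ℝ) * b)) := by
  have hN0 : (0 : ℝ) < N := by exact_mod_cast (show 0 < N by omega)
  have habs : |(N : ℝ) * b| / N = b := by rw [abs_of_nonneg (by positivity)]; field_simp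
  have hR : 6 * b < 1 / 2 := by linarith
  have hden : 0 < 1 / 2 - 6 * b := by linarith
  have hK : (0 : ℝ) ≤ 1 / (1 / 2 - 6 * b) := by positivity
  have hc1 : 18 * b / (1 / 2 - 6 * b) < 1 := by rw [div_lt_one hden]; linarith
  refine heatBathPoincare_of_oneLinkKRModulus (N := N) (by omega) (β := (N : ℝ) * b) hK (R := 6 * b) ?_
    (StrongCouplingKernelWindow.oneLinkKRModulus_SU hN hR) (c := 18 * b / (1 / 2 - 6 * b)) ?_ hc1 hL F hF hFb
  · rw [habs]; linarith
  · rw [habs]; exact le_of_eq (by field_simp)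

/-- ★★ **`SU(3)`, `d = 4`, HYPOTHESIS-FREE (certified PV2 modulus `OneLinkKRModulus 3 (1/5) (2679/1250)`): the heat-bath Poincaré inequality uniformly in
the volume on `0 ≤ β_W < 625/2679 ≈ 0.233`** (tree coupling `β_W/3`; constant `(2(1 − 2679β_W/625))⁻¹`, every torus side `L ≥ 2`). [folklore] -/
theorem su3_heatBathPoincare_pv2 {βW : ℝ} (h0 : 0 ≤ βW) (h : βW < 625 / 2679) {L : ℕ} [NeZero L] (hL : 1 < L)
    (F : Literature.MathematicalPhysics.QuantumFieldTheory.GaugeConfig 4 L (Matrix.specialUnitaryGroup (Fin 3) ℂ) → ℝ) (hF : Measurable F)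
    (hFb : ∃ M : ℝ, ∀ U, |F U| ≤ M) :
    ProbabilityTheory.variance F
        (Literature.MathematicalPhysics.QuantumFieldTheory.wilsonMeasure (d := 4) (L := L) (fundamentalRep (Fin 3)) (βW / 3)) ≤
      (2 * (1 - 2679 * βW / 625))⁻¹ *
        ∑ ℓ : Literature.MathematicalPhysics.QuantumFieldTheory.Edge 4 L, ∫ U, ∫ g, (F U - F (update U ℓ g)) ^ 2
          ∂((Literature.MathematicalPhysics.QuantumFieldTheory.haarProbability (Matrix.specialUnitaryGroup (Fin 3) ℂ)).tilted
              (fun g' => -(βW / 3) *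
                Literature.MathematicalPhysics.QuantumFieldTheory.wilsonAction (fundamentalRep (Fin 3)) (update U ℓ g')))
          ∂(Literature.MathematicalPhysics.QuantumFieldTheory.wilsonMeasure (d := 4) (L := L) (fundamentalRep (Fin 3)) (βW / 3)) := by
  have habs : |βW / 3| / ((3 : ℕ) : ℝ) = βW / 9 := by rw [abs_of_nonneg (by positivity)]; push_cast; ring
  exact heatBathPoincare_of_oneLinkKRModulus (N := 3) (by norm_num) (β := βW / 3) (by norm_num) (R := 1 / 5)
    (by rw [habs]; linarith) OneLinkVarianceSDC.su3_oneLinkKRModulus_pv2_oneFifth (c := 2679 * βW / 625)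
    (by rw [habs]; linarith) (by rw [div_lt_one (by norm_num)]; linarith) hL F hF hFb

end Summit.Ventures.YMGap.RobustBall.HeatBathPoincare

end
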